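import Summits.QuantumAdvantage.AdviceFreeQNC0.RingHardOdd
import Summits.QuantumAdvantage.AdviceFreeQNC0.RingCanonical
import Mathlib.Analysis.Complex.Norm
import Mathlib.Analysis.SpecialFunctions.Complex.CircleAddChar
import HarnessLib

/-!
# Cell qa-qnc0, rung F-Q2-odd (`p = 3`), planner qa-qnc0-p1 g20 — the BOND TWIST, per-site contraction
(ROUND-19 §2; `exp20/Sketch20x.lean` §1, definitions VERBATIM; ask P-20a(1), first part)

The `p = 3`-SAFE twisted transfer lives on `ℂ^{ZMod 3 × Bool}` (walk position, previous spin): the bond-twisted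
averaging step `twAvgX ζ` sends `v` to `(S, a) ↦ ½(ζ·v(S + spin a, a) + v(S + spin ¬a, ¬a))`.  This file
proves the two analytic inputs of `TwistBoundX3`:

* `twAvgX_core` — for a primitive cube root of unity `ζ`: `‖ζa + b‖² + ‖a + ζb‖² ≤ 3(‖a‖² + ‖b‖²)`
  (`= 2‖a‖² + 2‖b‖² + 2Re((ζ + ζ̄) a b̄)` and `ζ + ζ̄ = −1`);
* `cnsq6_twAvgX_le` — the per-site contraction `‖twAvgX ζ v‖² ≤ (3/4)‖v‖²` for `ζ = e₃(j)`, `j ≠ 0`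
  (re-index `(S, a) ↦ (v(S+1, true), v(S−1, false))` and apply the core inequality pointwise).

WHAT THIS IS NOT: the path-sum identity and `twistBoundX3 : TwistBoundX3` itself (the 6-state chain) are not
here; nothing touches the entangled dense residual of crux 22907; separation NOT moved.
-/

noncomputable section

namespace Summit.QuantumAdvantage.AdviceFreeQNC0

open Finset Literature.Computability.QuantumComplexity

namespace BondTwist3

/-! ## §1 The bond-twisted step on `ZMod 3 × Bool` (Sketch20x §1, verbatim) -/

/-- The spin of a Boolean flag: `true ↦ +1`, `false ↦ −1 (= 2)`. -/
def spinZ (a : Bool) : ZMod 3 := if a then 1 else -1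

/-- Squared `ℓ²` norm on `ZMod 3 × Bool` (walk position, previous spin). -/
noncomputable def cnsq6 (v : ZMod 3 → Bool → ℂ) : ℝ := ∑ s : ZMod 3, (‖v s true‖ ^ 2 + ‖v s false‖ ^ 2)

/-- The BOND-TWISTED averaging step (x-frame): from state `(S, a)` the next input bit is `1` (no zero: spin kept,
`S ↦ S + spin`, phase `ζ`) or `0` (a zero: spin flipped, `S ↦ S + new spin`, phase `1`), each with weight `½`. -/
noncomputable def twAvgX (ζ : ℂ) (v : ZMod 3 → Bool → ℂ) : ZMod 3 → Bool → ℂ :=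
  fun S a => (ζ * v (S + spinZ a) a + v (S + spinZ (!a)) (!a)) / 2

/-- **`TwistBoundX3`** (the `p = 3`-safe twist; bell frame = the frame of R0 `RingFixedBellsSharp3`): for every FIXED
bell set `B` and every `γ ∈ (ZMod 3)^N`, the correlation of the win indicator of the constant-bell strategy (output
`tGuess ⊕ 1_B`) on the odd class with the x-LINEAR phase `e₃(Σ_{i : x_i} γ_i)` is
`≤ A·(√3/2)^{#supp γ}·2^N`.  (Sketch20x §1, verbatim; NOT proved here.) -/
def TwistBoundX3 : Prop :=
  open scoped Classical in
  ∃ A : ℝ, ∀ (N : ℕ) (B : Finset (Fin N)) (γ : Fin N → ZMod 3),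
    ‖∑ x : Fin N → Bool,
        (ZMod.stdAddChar (∑ i : Fin N, if x i then γ i else 0) : ℂ) *
          (if (OddZeros x ∧ RingHLF.Rel x (fun k => xor (tGuess x k) (decide (k ∈ B)))) then (1 : ℂ) else 0)‖
      ≤ A * (Real.sqrt 3 / 2) ^ (univ.filter fun i : Fin N => γ i ≠ 0).card * (2 : ℝ) ^ N

/-! ## The core inequality -/

/-- A primitive cube root of unity has `normSq = 1`. -/
theorem normSq_of_cube_root {ζ : ℂ} (hζ3 : ζ ^ 3 = 1) : Complex.normSq ζ = 1 := by
  have h : Complex.normSq ζ ^ 3 = 1 := by rw [← map_pow, hζ3, map_one]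
  exact (pow_eq_one_iff_of_nonneg (Complex.normSq_nonneg ζ) (by norm_num)).1 h

/-- A primitive cube root of unity satisfies `ζ + ζ̄ = −1`. -/
theorem add_conj_of_cube_root {ζ : ℂ} (hζ3 : ζ ^ 3 = 1) (hζ1 : ζ ≠ 1) :
    ζ + (starRingEnd ℂ) ζ = -1 := by
  have hn := normSq_of_cube_root hζ3
  have hζ0 : ζ ≠ 0 := fun h => by rw [h, map_zero] at hn; exact zero_ne_one hn
  -- `conj ζ = ζ⁻¹ = ζ²`
  have hconj : (starRingEnd ℂ) ζ = ζ ^ 2 := by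
    have hinv : ζ⁻¹ = (starRingEnd ℂ) ζ := by rw [Complex.inv_def, hn]; simp
    have hinv' : ζ⁻¹ = ζ ^ 2 := inv_eq_of_mul_eq_one_right (by rw [← pow_succ', hζ3])
    rw [← hinv, hinv']
  rw [hconj]
  -- `ζ² + ζ + 1 = 0` from `ζ³ = 1`, `ζ ≠ 1`
  have hfac : (ζ - 1) * (ζ ^ 2 + ζ + 1) = 0 := by linear_combination hζ3
  rcases mul_eq_zero.1 hfac with h | h
  · exact absurd (sub_eq_zero.1 h) hζ1
  · linear_combination h

/-- **Core inequality** (three lines by hand): for a primitive cube root of unity `ζ`,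
`‖ζa + b‖² + ‖a + ζb‖² ≤ 3(‖a‖² + ‖b‖²)`. -/
theorem twAvgX_core (ζ : ℂ) (hζ3 : ζ ^ 3 = 1) (hζ1 : ζ ≠ 1) (a b : ℂ) :
    ‖ζ * a + b‖ ^ 2 + ‖a + ζ * b‖ ^ 2 ≤ 3 * (‖a‖ ^ 2 + ‖b‖ ^ 2) := by
  have hn := normSq_of_cube_root hζ3
  have hsum := add_conj_of_cube_root hζ3 hζ1
  rw [Complex.sq_norm, Complex.sq_norm, Complex.sq_norm, Complex.sq_norm, Complex.normSq_add,
    Complex.normSq_add, Complex.normSq_mul, Complex.normSq_mul, hn, one_mul, one_mul]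
  -- the cross terms: `(ζ a b̄).re + (a (ζb)‾).re = ((ζ + ζ̄) a b̄).re = −(a b̄).re`
  have hcross : (ζ * a * (starRingEnd ℂ) b).re + (a * (starRingEnd ℂ) (ζ * b)).re =
      -(a * (starRingEnd ℂ) b).re := by
    rw [map_mul, ← Complex.add_re]
    have : ζ * a * (starRingEnd ℂ) b + a * ((starRingEnd ℂ) ζ * (starRingEnd ℂ) b) =
        (ζ + (starRingEnd ℂ) ζ) * (a * (starRingEnd ℂ) b) := by ring
    rw [this, hsum, neg_one_mul, Complex.neg_re]
  have hre : |(a * (starRingEnd ℂ) b).re| ≤ ‖a‖ * ‖b‖ := by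
    calc |(a * (starRingEnd ℂ) b).re| ≤ ‖a * (starRingEnd ℂ) b‖ := Complex.abs_re_le_norm _
      _ = ‖a‖ * ‖b‖ := by rw [norm_mul, Complex.norm_conj]
  have ha : Complex.normSq a = ‖a‖ ^ 2 := Complex.normSq_eq_norm_sq a
  have hb : Complex.normSq b = ‖b‖ ^ 2 := Complex.normSq_eq_norm_sq b
  have habs := abs_le.1 hre
  nlinarith [sq_nonneg (‖a‖ - ‖b‖), norm_nonneg a, norm_nonneg b, hcross, habs.1, habs.2]

/-- The additive character `e₃(j)` is a primitive cube root of unity for `j ≠ 0`. -/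
theorem stdAddChar_cube (j : ZMod 3) : (ZMod.stdAddChar j : ℂ) ^ 3 = 1 := by
  rw [← AddChar.map_nsmul_eq_pow]
  have : (3 : ℕ) • j = 0 := by
    have h3 : ((3 : ℕ) : ZMod 3) = 0 := by decide
    rw [nsmul_eq_mul, h3, zero_mul]
  rw [this, AddChar.map_zero_eq_one]

/-- `e₃(j) ≠ 1` for `j ≠ 0` (primitivity of the standard additive character). -/
theorem stdAddChar_ne_one {j : ZMod 3} (hj : j ≠ 0) : (ZMod.stdAddChar j : ℂ) ≠ 1 := by
  intro h
  apply ZMod.isPrimitive_stdAddChar 3 hj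
  ext x
  rw [AddChar.mulShift_apply, AddChar.one_apply,
    show j * x = x.val • j by rw [nsmul_eq_mul, ZMod.natCast_zmod_val, mul_comm],
    AddChar.map_nsmul_eq_pow, h, one_pow]

/-- Sums over `ZMod 3`, explicitly. -/
theorem sum_zmod3 (f : ZMod 3 → ℝ) : ∑ s, f s = f 0 + f 1 + f 2 := by
  have h : (univ : Finset (ZMod 3)) = {0, 1, 2} := by decide
  rw [h, sum_insert (by decide), sum_insert (by decide), sum_singleton, add_assoc]

/-! ## The per-site contraction -/

/-- **Per-site contraction `‖twAvgX ζ‖² ≤ 3/4`** for `ζ = e₃(j)`, `j ≠ 0`. -/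
theorem cnsq6_twAvgX_le (j : ZMod 3) (hj : j ≠ 0) (v : ZMod 3 → Bool → ℂ) :
    cnsq6 (twAvgX (ZMod.stdAddChar j : ℂ) v) ≤ (3 / 4 : ℝ) * cnsq6 v := by
  set ζ : ℂ := (ZMod.stdAddChar j : ℂ) with hζ
  have hcore := twAvgX_core ζ (stdAddChar_cube j) (stdAddChar_ne_one hj)
  have hterm : ∀ a b : ℂ, ‖(ζ * a + b) / 2‖ ^ 2 + ‖(ζ * b + a) / 2‖ ^ 2 ≤ (3 / 4) * (‖a‖ ^ 2 + ‖b‖ ^ 2) := by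
    intro a b
    rw [norm_div, norm_div, div_pow, div_pow, Complex.norm_ofNat, show ζ * b + a = a + ζ * b from add_comm _ _]
    have := hcore a b
    nlinarith
  have s1 : spinZ true = 1 := rfl
  have s2 : spinZ false = -1 := rfl
  unfold cnsq6 twAvgX
  simp only [Bool.not_true, Bool.not_false, s1, s2]
  rw [sum_zmod3, sum_zmod3]
  have e01 : (0 : ZMod 3) + 1 = 1 := by decide
  have e02 : (0 : ZMod 3) + -1 = 2 := by decide
  have e11 : (1 : ZMod 3) + 1 = 2 := by decide
  have e12 : (1 : ZMod 3) + -1 = 0 := by decide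
  have e21 : (2 : ZMod 3) + 1 = 0 := by decide
  have e22 : (2 : ZMod 3) + -1 = 1 := by decide
  simp only [e01, e02, e11, e12, e21, e22]
  have t0 := hterm (v 1 true) (v 2 false)
  have t1 := hterm (v 2 true) (v 0 false)
  have t2 := hterm (v 0 true) (v 1 false)
  nlinarith [t0, t1, t2]

end BondTwist3

end Summit.QuantumAdvantage.AdviceFreeQNC0

end
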